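import Summits.ValiantsHypothesis.ValiantsHypothesis.Theorems.KPlusLogSqLawTropicalBCrossingChains

/-!
# Route «KPlusLogSqLaw», crux `TropicalB` (stmt-ValiantsHypothesis-19771) — THE VISITED-IMAGE LAW ALONG ONE CHAIN:
# in every design, `n + 1 ≤ (mK+1)·(2V)^{⌊log₂ m⌋+1}`, `V` = the largest number of row images of a column interval visited by the chain

HONEST FRAMING.  Helper toward the registered stubs `stub_tropThin` / `stub_tropFat` of `Cruxes/TropicalB/Lines/birth.lean` (crux
`Summit.ValiantsHypothesis.ValiantsHypothesis.Theses.KPlusLogSqLaw.TropicalB`, item stmt-ValiantsHypothesis-19771, route KPlusLogSqLaw,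
DRAFT; cell `pub-symmetroid`, seat val-sym-trop-p1 g7, 2026-08-27; `--supports … --as helper`).  A STRUCTURE theorem about one
dominant chain of an ARBITRARY design; it is an identity-type recursion (the chain is bounded by quantities read off the chain) and
does NOT bound `TropicalB`; nothing here bears on `TropicalB` in its window, `WeakLifting`, DoorA26 / DoorA34, `MatrixDescartes`
(stmt-ValiantsHypothesis-18050) or VP ≠ VNP.

THE LAW.  Let `p₀, …, pₙ` be dominant at strictly increasing integer slopes with distinct consecutive terms, in any design of format
`(m, K)`.  For a column interval `[a, t)` let `V(a,t) = #{σ_k([a, t)) : k ≤ n}` be the number of row images the chain VISITS there,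
and `V ≥ max_{a,t} V(a,t)`, `V ≥ 1`.  Then

  `n + 1 ≤ (mK + 1) · (2V)^{⌊log₂ m⌋ + 1}`      (`chain_le_of_visitedImages`).

Proof: the state-count recursion of `…TropicalBUpperBand` carried with the predicate «is a term of the chain»
(`IntervalOpt.chain_le_of_states_pred`, …TropicalBCrossingChains): Gusfield's recursion over (column interval, row image) pairs only
ever restricts the chain's own terms, so the state families may be taken to be the images the chain visits.  This is the fully
recursive, chain-intrinsic form of the «reading for general supports» recorded after `chain_le_card_states_mul` (…TropicalBChainSplit,
one level, universal sub-bounds) and of the visited-state engine (…TropicalBVisitedStates, hereditary classes with a universal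
visited-state bound — a UNIVERSAL visited-state law for dense supports is false, val-sym-trop-p2 g8 note VS-CANDIDATE-FOR-TROP-P1.md:
static dense `(4,4)` / `(5,4)` chains visit all `C(4,2)` / `C(5,2)` states).  Consequences recorded here:

* `chain_le_two_pow_of_poly_visitedImages` — if the chain visits at most `(m+1)^w` images on every column interval, then
  `n ≤ 2^{(20w+8)(K + ⌊log₂ m⌋²)}` (TropicalB's bound FOR THAT CHAIN; the crossing theorem `crossing_chain_le_two_pow` is the case
  where the bound on images comes from crossing numbers);
* `exists_many_visitedImages_of_long_chain` — contrapositive, the located statement for the construction side: a chain with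
  `n + 1 > (mK+1)·(2V)^{⌊log₂ m⌋+1}` visits MORE than `V` distinct row images on some column interval; in particular a counterexample
  chain to the `K + log² m` law with constant `C` visits more than `2^{(C(K+⌊log₂ m⌋²) − ⌊log₂(mK+1)⌋ − ⌊log₂ m⌋ − 2)/(⌊log₂ m⌋+1)}`-ish
  images somewhere — super-polynomially many in the fat regime `K ≫ log m · log log m` (not formalised as a closed form; the
  inequality is the theorem).

[folklore] D. Gusfield (1980), divide and conquer for parametric shortest paths; the chain-intrinsic bookkeeping is this file's.
-/

set_option linter.dupNamespace false
set_option autoImplicit false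

namespace Summit.ValiantsHypothesis.ValiantsHypothesis.Theorems.KPlusLogSqLaw

open Summit.ValiantsHypothesis.ValiantsHypothesis.Theorems.MatrixDescartes.Negative
open Summit.ValiantsHypothesis.ValiantsHypothesis.Theorems.LacunarySymmetroidMatrixDescartes
open scoped BigOperators
open Finset

namespace IntervalOpt

variable {m K : ℕ} {d : Fin K → ℕ} {v ε : Fin m → Fin m → Fin K → ℤ}

/-- **THE VISITED-IMAGE LAW.**  In ANY design of format `(m, K)`: if a dominant chain `p₀, …, pₙ` (strictly increasing integer
slopes, distinct consecutive terms) visits at most `V ≥ 1` distinct row images `σ_k([a, t))` on every column interval `[a, t)`, then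
`n + 1 ≤ (mK+1)·(2V)^{⌊log₂ m⌋+1}`. [folklore: Gusfield 1980, chain-intrinsic form] -/
theorem chain_le_of_visitedImages {n : ℕ} (θ : Fin (n + 1) → ℤ) (p : Fin (n + 1) → Equiv.Perm (Fin m) × (Fin m → Fin K))
    (hθ : StrictMono θ) (hdom : ∀ k, IsDominant d v ε (θ k) (p k)) (hne : ∀ k : Fin n, p k.castSucc ≠ p k.succ)
    (V : ℕ) (hV1 : 1 ≤ V)
    (hV : ∀ a t : ℕ, ((Finset.univ : Finset (Fin (n + 1))).image fun k => (ico m a t).image (p k).1).card ≤ V) :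
    n + 1 ≤ (m * K + 1) * (2 * V) ^ (Nat.log 2 m + 1) := by
  classical
  exact chain_le_of_states_pred (d := d) (v := v) (ε := ε) (fun q => ∃ k, p k = q)
    (fun a t => (Finset.univ : Finset (Fin (n + 1))).image fun k => (ico m a t).image (p k).1) V hV1 hV
    (fun q _ hq a t => by
      obtain ⟨k, rfl⟩ := hq
      exact Finset.mem_image.2 ⟨k, Finset.mem_univ _, rfl⟩)
    θ p hθ hdom hne (fun k => ⟨k, rfl⟩)

/-- **Contrapositive: long chains visit many images.**  If `(mK+1)·(2V)^{⌊log₂ m⌋+1} < n + 1` (`V ≥ 1`) then on some column interval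
the chain visits more than `V` distinct row images. [folklore] -/
theorem exists_many_visitedImages_of_long_chain {n : ℕ} (θ : Fin (n + 1) → ℤ)
    (p : Fin (n + 1) → Equiv.Perm (Fin m) × (Fin m → Fin K))
    (hθ : StrictMono θ) (hdom : ∀ k, IsDominant d v ε (θ k) (p k)) (hne : ∀ k : Fin n, p k.castSucc ≠ p k.succ)
    (V : ℕ) (hV1 : 1 ≤ V) (hn : (m * K + 1) * (2 * V) ^ (Nat.log 2 m + 1) < n + 1) :
    ∃ a t : ℕ, V < ((Finset.univ : Finset (Fin (n + 1))).image fun k => (ico m a t).image (p k).1).card := by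
  by_contra h
  push Not at h
  exact absurd (chain_le_of_visitedImages (d := d) (v := v) (ε := ε) θ p hθ hdom hne V hV1 h) (not_le.mpr hn)

/-- **Polynomially many visited images ⇒ the `K + log² m` bound for that chain.**  If a dominant chain of any design of format
`(m, K)` visits at most `(m+1)^w` row images on every column interval, then `n ≤ 2^{(20w+8)(K + ⌊log₂ m⌋²)}` (arithmetic of
`upperBand_size_le_two_pow`, since `(m+1)^w ≤ ((2w+1)(m+1)^{2w})²`). [folklore] -/
theorem chain_le_two_pow_of_poly_visitedImages (w : ℕ) (d : Fin K → ℕ) (v ε : Fin m → Fin m → Fin K → ℤ) {n : ℕ}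
    (θ : Fin (n + 1) → ℤ) (p : Fin (n + 1) → Equiv.Perm (Fin m) × (Fin m → Fin K))
    (hθ : StrictMono θ) (hdom : ∀ k, IsDominant d v ε (θ k) (p k)) (hne : ∀ k : Fin n, p k.castSucc ≠ p k.succ)
    (hV : ∀ a t : ℕ, ((Finset.univ : Finset (Fin (n + 1))).image fun k => (ico m a t).image (p k).1).card ≤ (m + 1) ^ w) :
    n ≤ 2 ^ ((20 * w + 8) * (K + Nat.log 2 m ^ 2)) := by
  rcases Nat.eq_zero_or_pos K with hK | hK
  · subst hK
    exact (tropRowD_zero m 0 d v ε n θ p hθ hdom hne).trans (Nat.zero_le _)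
  · set T := ((2 * w + 1) * (m + 1) ^ (2 * w)) ^ 2 with hT
    have hmono : (m + 1) ^ w ≤ T := by
      have h1 : (m + 1) ^ w ≤ (m + 1) ^ (2 * w) := Nat.pow_le_pow_right (Nat.succ_pos _) (by omega)
      have h2 : (m + 1) ^ (2 * w) ≤ (2 * w + 1) * (m + 1) ^ (2 * w) := Nat.le_mul_of_pos_left _ (by omega)
      have h3 : (2 * w + 1) * (m + 1) ^ (2 * w) ≤ ((2 * w + 1) * (m + 1) ^ (2 * w)) ^ 2 := by
        rw [sq]; exact Nat.le_mul_of_pos_left _ (Nat.mul_pos (by omega) (Nat.pow_pos (Nat.succ_pos _)))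
      exact h1.trans (h2.trans h3)
    have hT1 : 1 ≤ T := (Nat.one_le_pow _ _ (Nat.succ_pos _)).trans hmono
    have h1 := chain_le_of_visitedImages (d := d) (v := v) (ε := ε) θ p hθ hdom hne T hT1 (fun a t => (hV a t).trans hmono)
    have h2 : (m * K + 1) * (2 * T) ^ (Nat.log 2 m + 1) ≤ 2 ^ ((20 * w + 8) * (K + Nat.log 2 m ^ 2)) :=
      upperBand_size_le_two_pow m K w hK
    omega

end IntervalOpt

open IntervalOpt in
/-- **VISITED-IMAGE LAW (crux currency, polynomial case).**  For every `w` there is `C` (`= 20w + 8`) such that for ALL `m, K` and EVERY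
design of format `(m, K)`, a sign-alternating chain of dominant terms at strictly increasing integer slopes that visits at most
`(m+1)^w` distinct row images `σ_k([a, t))` on every column interval has `n ≤ 2^{C (K + ⌊log₂ m⌋²)}`. [folklore: Gusfield 1980] -/
theorem tropicalB_polyVisitedImages (w : ℕ) : ∃ C : ℕ, ∀ (m K : ℕ) (d : Fin K → ℕ) (v ε : Fin m → Fin m → Fin K → ℤ) (n : ℕ)
    (θ : Fin (n + 1) → ℤ) (p : Fin (n + 1) → Equiv.Perm (Fin m) × (Fin m → Fin K)),
    (∀ a t : ℕ, ((Finset.univ : Finset (Fin (n + 1))).image fun k => (ico m a t).image (p k).1).card ≤ (m + 1) ^ w) →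
    (∀ i j l, (ε i j l).natAbs ≤ 1) → StrictMono θ →
    (∀ k, IsDominant d v ε (θ k) (p k)) → (∀ k : Fin n, termSign ε (p k.castSucc) * termSign ε (p k.succ) < 0) →
    n ≤ 2 ^ (C * (K + Nat.log 2 m ^ 2)) :=
  ⟨20 * w + 8, fun _ _ d v ε _ θ p hV _ hθ hdom halt =>
    chain_le_two_pow_of_poly_visitedImages w d v ε θ p hθ hdom (ne_succ_of_alternating ε p halt) hV⟩

end Summit.ValiantsHypothesis.ValiantsHypothesis.Theorems.KPlusLogSqLaw
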